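import Mathlib
import HarnessLib
import Literature.Analysis.Convex.SemidefiniteStepLength

/-!
# The primal–dual interior-point Newton direction for inequality-constrained nonlinear programmes,
# its dual normal matrix, and the merit function `ψ_{β,τ}`
# (Antoniou–Lu 2007, §15.4.1–§15.4.3, (15.48)–(15.60), (15.63)–(15.65); Problems 15.6–15.9)

Source: A. Antoniou, W.-S. Lu, *Practical Optimization: Algorithms and Engineering Applications*,
Springer (2007) [AntoniouLu2007], §15.4 *Interior-point methods* (for the general problem
`minimize f(x) subject to c_j(x) ≥ 0`, (15.45)): §15.4.1 *KKT conditions and search direction*,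
§15.4.2 *A merit function for convex problems*, §15.4.3 *Algorithm modifications for nonconvex
problems*, and Problems 15.6–15.9 (held copy read; section / equation / problem numbers cited).
The method is the one of the book's references [12], [13] of Ch. 15 (Vanderbei–Shanno).

Setting (one iteration, all data fixed). Variables `x ∈ ℝ^ι`, slacks `y ∈ ℝ^κ` with `y > 0` and
multipliers `λ ∈ ℝ^κ` ((15.46)–(15.48)); at the current point: `g = ∇f(x)`, `A = A(x)` the Jacobian
of `c` (rows `∇c_jᵀ`), `c = c(x)`, `H = H(x, λ) = ∇²f(x) − Σ λ_j ∇²c_j(x)` ((15.51)),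
`Y = diag(y)`, `Λ = diag(λ)`, barrier parameter `τ > 0`. The perturbed KKT conditions are
`g − Aᵀλ = 0`, `YΛe = τe`, `c − y = 0` ((15.48)) and the Newton direction `{Δx, Δy, Δλ}` solves

  `H Δx − Aᵀ Δλ = −g + Aᵀλ`, `Λ Δy + Y Δλ = τe − YΛe`, `A Δx − Δy = −c + y`      ((15.50)).

What is proved (everything below is a theorem; no named facts, no `sorry`):

* (15.52) `isNewtonDir_iff_symm` — (15.50) is equivalent to the symmetrised system with right-hand
  side `σ = g − Aᵀλ` ((15.52b)), `−γ`, `γ = τY⁻¹e − λ` ((15.52c)), `ρ = y − c` ((15.52d)).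
* (15.55)–(15.56), Problem 15.6: `isNewtonDir_iff_explicit` — (15.50) holds iff
  `N Δx = −ξ + AᵀY⁻¹Λρ`, `Δy = A Δx − ρ` and `Δλ = Y⁻¹Λ(ρ − A Δx) + γ` ((15.55b,c)), where
  `N = H + AᵀY⁻¹ΛA` is the *dual normal matrix* ((15.56), `dualNormal`) and
  `ξ = g − τAᵀY⁻¹e` (`xi`) — here `Δy` is eliminated through the third block row and `Δλ` through
  the second, the text goes through (15.53)–(15.54), with the same end result (15.55); for
  invertible `N`, `newtonDir_dx_eq` / `newtonDir_dx_eq_three_terms` give (15.55a)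
  `Δx = −N⁻¹g + τN⁻¹AᵀY⁻¹e + N⁻¹AᵀY⁻¹Λρ`, and `isNewtonDir_of_explicit` shows that (15.55) does
  solve (15.50).
* Problem 15.7: `posDef_dualNormal` — `H ≻ 0`, `y > 0`, `λ ≥ 0 ⟹ N ≻ 0`; also
  `posSemidef_dualNormal` (`H ⪰ 0 ⟹ N ⪰ 0`) and `posDef_dualNormal_of_injective` (`H ⪰ 0`,
  `λ > 0`, `A` of full column rank `⟹ N ≻ 0`), which is what the convex case of §15.4.2 ("`f`
  convex, `c_j` concave, `λ > 0`") actually needs besides `H ⪰ 0`; `multiplier_pos_of_central` is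
  the remark that (15.48b) with `τ > 0`, `y > 0` forces `λ > 0`.
* (15.57)–(15.58), Problem 15.8: for the merit function
  `ψ_{β,τ}(x, y) = f(x) − τ Σ ln yᵢ + (β/2)‖y − c(x)‖²` ((15.57)), `hasDerivAt_merit_line` computes
  the derivative at `α = 0` of `α ↦ ψ_{β,τ}(x + αΔx, y + αΔy)` from the derivatives of `f` and `c`
  along the line, `meritLineDeriv_eq_meritSlope` identifies it with
  `s = ∇ₓψᵀΔx + ∇_yψᵀΔy`, `∇ₓψ = g − βAᵀρ`, `∇_yψ = −τY⁻¹e + βρ` (`meritSlope`), and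
  `meritSlope_eq` is (15.58): `s = −ξᵀN⁻¹ξ + τeᵀY⁻¹ρ + ξᵀN⁻¹AᵀY⁻¹Λρ − β‖ρ‖²` whenever
  `Δy = AΔx − ρ` and `NΔx = −ξ + AᵀY⁻¹Λρ` (any invertible `N`, so it also covers the modified
  matrix of (15.64)).
* (15.59)–(15.60), Problem 15.9: `meritSlope_eq_sub_beta` (`s(β) = s(0) − β‖ρ‖²`),
  `meritSlope_neg_of_betaMin_lt` (`ρ ≠ 0`, `β > β_min = s(0)/‖ρ‖² ⟹ s < 0`),
  `meritSlope_nonpos_of_betaMin_le` and `meritSlope_eq_zero_of_eq_betaMin` (at `β = β_min`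
  exactly `s = 0`, so "negative if `β ≥ β_min`" in Problem 15.9 needs `β > β_min` — the text takes
  `β = 10 β_min`), `meritSlope_neg_of_feasible` (`ρ = 0`, `N ≻ 0`, `ξ ≠ 0 ⟹ s < 0` for every `β`)
  and `descent_obstruction_nonneg` / `descent_obstruction_pos` (the necessity statement around
  (15.59): if `N ≻ 0`, `β ≥ 0` and `s ≥ 0` then `τeᵀY⁻¹ρ + ξᵀN⁻¹AᵀY⁻¹Λρ ≥ ξᵀN⁻¹ξ + β‖ρ‖² ≥ 0`,
  `> 0` if `ξ ≠ 0`).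
* (15.63)–(15.65): `posDef_dualNormal_shift` — if `η > −λᵢ(H)` for every eigenvalue of `H`
  then `Ĥ = H + ηI ≻ 0` (this equivalence is
  `Literature.Analysis.Convex.SemidefiniteStepLength.add_smul_one_posDef_iff_eigenvalues`, imported)
  and the modified dual normal matrix `N̂ = Ĥ + AᵀY⁻¹ΛA` ((15.64)) is positive definite;
  `posDef_dualNormal_eta_bar` — the text's bound `η̄ = 1.2 η₀` (`η₀ > 0` the magnitude of the most
  negative eigenvalue) already works.

Related, not restated: the analogous elimination for the Boyd–Vandenberghe primal–dual system
without slack variables ((11.54)–(11.56), `H_pd = M + Dfᵀ diag(λ/(−f)) Df`) is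
`Literature.Analysis.Convex.PrimalDualSearchDirection`; the LP / QP specialisations of the
path-following Newton step are `Literature.Analysis.Convex.LPPrimalDualPathFollowing`. Not
formalised: Algorithms 15.5 / 15.6 themselves (line search, stopping rule, the halving search
(15.65) for `η`) and any convergence claim.
-/

open Matrix Finset

namespace Literature.Analysis.Convex.InteriorPointMeritFunction

variable {ι κ : Type*} [Fintype ι] [Fintype κ] [DecidableEq ι] [DecidableEq κ]

/-! ## The Newton system (15.50), the dual normal matrix (15.56) and the vector `ξ` -/

/-- The Newton direction `{Δx, Δy, Δλ}` of (15.50) at the data `(H, A, g, c, y, λ, τ)`: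
`H Δx − Aᵀ Δλ = −g + Aᵀλ`, `Λ Δy + Y Δλ = τe − YΛe` (componentwise), `A Δx − Δy = −c + y`.
[cite: AntoniouLu2007, §15.4.1 (15.50)] -/
def IsNewtonDir (H : Matrix ι ι ℝ) (A : Matrix κ ι ℝ) (g : ι → ℝ) (c y lam : κ → ℝ) (τ : ℝ)
    (dx : ι → ℝ) (dy dlam : κ → ℝ) : Prop :=
  H *ᵥ dx - Aᵀ *ᵥ dlam = -g + Aᵀ *ᵥ lam ∧
    (∀ j, lam j * dy j + y j * dlam j = τ - y j * lam j) ∧ A *ᵥ dx - dy = -c + y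

/-- The dual normal matrix `N(x, y, λ) = H(x, λ) + Aᵀ(x) Y⁻¹ Λ A(x)`.
[cite: AntoniouLu2007, §15.4.1 (15.56)] -/
noncomputable def dualNormal (H : Matrix ι ι ℝ) (A : Matrix κ ι ℝ) (y lam : κ → ℝ) : Matrix ι ι ℝ :=
  H + Aᵀ * diagonal (fun j => lam j / y j) * A

/-- The vector `ξ = g − τ Aᵀ Y⁻¹ e` of (15.58) (so that `−ξ + AᵀY⁻¹Λρ` is the right-hand side of
the reduced equation `N Δx = …` behind (15.55a)). [cite: AntoniouLu2007, §15.4.2 (15.58)] -/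
noncomputable def xi (g : ι → ℝ) (A : Matrix κ ι ℝ) (y : κ → ℝ) (τ : ℝ) : ι → ℝ :=
  g - Aᵀ *ᵥ fun j => τ / y j

omit [Fintype ι] [DecidableEq ι] in
/-- `diag(d) v = (d_j v_j)_j`. [folklore] -/
private theorem diagonal_mulVec_eq (d v : κ → ℝ) : diagonal d *ᵥ v = fun j => d j * v j :=
  funext fun j => mulVec_diagonal d v j

omit [DecidableEq ι] in
/-- `N Δx = H Δx + Aᵀ (Y⁻¹Λ (A Δx))`. [cite: AntoniouLu2007, §15.4.1 (15.56)] -/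
theorem dualNormal_mulVec (H : Matrix ι ι ℝ) (A : Matrix κ ι ℝ) (y lam : κ → ℝ) (dx : ι → ℝ) :
    dualNormal H A y lam *ᵥ dx = H *ᵥ dx + Aᵀ *ᵥ fun j => lam j / y j * (A *ᵥ dx) j := by
  simp only [dualNormal, add_mulVec, ← mulVec_mulVec, diagonal_mulVec_eq]

omit [Fintype ι] [DecidableEq ι] in
/-- `N` is symmetric when `H` is. [cite: AntoniouLu2007, §15.4.1 (15.56)] -/
theorem isHermitian_dualNormal {H : Matrix ι ι ℝ} (hH : H.IsHermitian) (A : Matrix κ ι ℝ)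
    (y lam : κ → ℝ) : (dualNormal H A y lam).IsHermitian := by
  unfold dualNormal
  refine hH.add ?_
  have h := isHermitian_conjTranspose_mul_mul A (isHermitian_diagonal_of_self_adjoint
    (fun j => lam j / y j) (funext fun j => by simp))
  simpa only [conjTranspose_eq_transpose_of_trivial] using h

/-! ## (15.52): the symmetrised Newton system -/

omit [DecidableEq ι] [DecidableEq κ] in
/-- (15.50) is equivalent to the symmetrised system (15.52a) with right-hand side
`(σ, −γ, ρ)`, `σ = g − Aᵀλ` ((15.52b)), `γ = τY⁻¹e − λ` ((15.52c)), `ρ = y − c` ((15.52d))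
(multiply the first block row by `−I` and the second by `−Y⁻¹`).
[cite: AntoniouLu2007, §15.4.1 (15.52a)–(15.52d)] -/
theorem isNewtonDir_iff_symm (H : Matrix ι ι ℝ) (A : Matrix κ ι ℝ) (g : ι → ℝ) (c lam : κ → ℝ)
    {y : κ → ℝ} (hy : ∀ j, 0 < y j) (τ : ℝ) (dx : ι → ℝ) (dy dlam : κ → ℝ) :
    IsNewtonDir H A g c y lam τ dx dy dlam ↔
      (-(H *ᵥ dx) + Aᵀ *ᵥ dlam = g - Aᵀ *ᵥ lam ∧
        (∀ j, -(lam j / y j * dy j) - dlam j = -(τ / y j - lam j)) ∧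
        A *ᵥ dx - dy = y - c) := by
  unfold IsNewtonDir
  refine and_congr ?_ (and_congr (forall_congr' fun j => ?_) (by rw [neg_add_eq_sub]))
  · constructor <;> intro h <;> funext i <;> have hi := congrFun h i <;>
      simp only [Pi.add_apply, Pi.sub_apply, Pi.neg_apply] at hi ⊢ <;> linarith
  · have hyj : y j ≠ 0 := (hy j).ne'
    have e1 : lam j * dy j = y j * (lam j / y j * dy j) := by field_simp
    have e2 : y j * (τ / y j) = τ := by field_simp
    constructor <;> intro h
    · have e3 : y j * (lam j / y j * dy j + dlam j - (τ / y j - lam j)) = 0 := by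
        rw [mul_sub, mul_add, ← e1, mul_sub, e2]
        linarith
      have e4 := (mul_eq_zero.mp e3).resolve_left hyj
      linarith
    · have e3 : lam j / y j * dy j + dlam j = τ / y j - lam j := by linarith
      calc lam j * dy j + y j * dlam j = y j * (lam j / y j * dy j + dlam j) := by
            rw [mul_add, ← e1]
        _ = τ - y j * lam j := by rw [e3, mul_sub, e2]

/-! ## (15.55)–(15.56), Problem 15.6: elimination and the explicit formulas -/

omit [DecidableEq ι] in
/-- Problem 15.6 / (15.55)–(15.56): `{Δx, Δy, Δλ}` solves (15.50) iff
`N Δx = −ξ + Aᵀ Y⁻¹Λ ρ`, `Δy = A Δx − ρ` and `Δλ = Y⁻¹Λ (ρ − A Δx) + γ`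
(`N` the dual normal matrix (15.56), `ρ = y − c`, `γ = τY⁻¹e − λ`, `ξ = g − τAᵀY⁻¹e`); the last
two are (15.55c) and the compact form of (15.55b) (the text eliminates through (15.53)–(15.54)
instead; the end result is the same). No invertibility of `N` is needed for the equivalence.
[cite: AntoniouLu2007, §15.4.1 (15.55)–(15.56); Problem 15.6] -/
theorem isNewtonDir_iff_explicit (H : Matrix ι ι ℝ) (A : Matrix κ ι ℝ) (g : ι → ℝ)
    (c lam : κ → ℝ) {y : κ → ℝ} (hy : ∀ j, 0 < y j) (τ : ℝ) (dx : ι → ℝ) (dy dlam : κ → ℝ) :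
    IsNewtonDir H A g c y lam τ dx dy dlam ↔
      (dualNormal H A y lam *ᵥ dx = -xi g A y τ + Aᵀ *ᵥ (fun j => lam j / y j * (y j - c j)) ∧
        dy = A *ᵥ dx - (y - c) ∧
        dlam = fun j => lam j / y j * ((y j - c j) - (A *ᵥ dx) j) + (τ / y j - lam j)) := by
  -- Step 1: rows 2 and 3 of (15.50) ⟺ the formulas for `Δy` and `Δλ`.
  have row3 : A *ᵥ dx - dy = -c + y ↔ dy = A *ᵥ dx - (y - c) := by
    constructor <;> intro h <;> funext j <;> have hj := congrFun h j <;>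
      simp only [Pi.add_apply, Pi.sub_apply, Pi.neg_apply] at hj ⊢ <;> linarith
  have row2 : ∀ j, dy j = (A *ᵥ dx) j - (y j - c j) →
      (lam j * dy j + y j * dlam j = τ - y j * lam j ↔
        dlam j = lam j / y j * ((y j - c j) - (A *ᵥ dx) j) + (τ / y j - lam j)) := by
    intro j hj
    have hyj : y j ≠ 0 := (hy j).ne'
    rw [hj]
    constructor <;> intro h
    · field_simp
      linarith
    · rw [h]
      field_simp
      ring
  -- Step 2: given the formula for `Δλ`, row 1 of (15.50) ⟺ the reduced equation `N Δx = …`.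
  have row1 : dlam = (fun j => lam j / y j * ((y j - c j) - (A *ᵥ dx) j) + (τ / y j - lam j)) →
      (H *ᵥ dx - Aᵀ *ᵥ dlam = -g + Aᵀ *ᵥ lam ↔
        dualNormal H A y lam *ᵥ dx =
          -xi g A y τ + Aᵀ *ᵥ fun j => lam j / y j * (y j - c j)) := by
    intro hdlam
    have hA : Aᵀ *ᵥ dlam = Aᵀ *ᵥ (fun j => lam j / y j * (y j - c j)) -
        Aᵀ *ᵥ (fun j => lam j / y j * (A *ᵥ dx) j) + Aᵀ *ᵥ (fun j => τ / y j) - Aᵀ *ᵥ lam := by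
      rw [hdlam, ← mulVec_sub, ← mulVec_add, ← mulVec_sub]
      congr 1
      funext j
      simp only [Pi.sub_apply, Pi.add_apply]
      ring
    rw [dualNormal_mulVec]
    unfold xi
    constructor <;> intro h <;> funext i <;> have hi := congrFun h i <;>
      have hAi := congrFun hA i <;>
      simp only [Pi.add_apply, Pi.sub_apply, Pi.neg_apply] at hi hAi ⊢ <;> linarith
  -- Assemble.
  unfold IsNewtonDir
  constructor
  · rintro ⟨h1, h2, h3⟩
    have hdy := row3.mp h3
    have hdlam : dlam = fun j => lam j / y j * ((y j - c j) - (A *ᵥ dx) j) + (τ / y j - lam j) :=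
      funext fun j => (row2 j (by rw [hdy]; rfl)).mp (h2 j)
    exact ⟨(row1 hdlam).mp h1, hdy, hdlam⟩
  · rintro ⟨h1, hdy, hdlam⟩
    exact ⟨(row1 hdlam).mpr h1, fun j => (row2 j (by rw [hdy]; rfl)).mpr (congrFun hdlam j),
      row3.mpr hdy⟩

/-- (15.55a), compact form: if the dual normal matrix is invertible, the Newton direction has
`Δx = N⁻¹ (−ξ + AᵀY⁻¹Λρ)`. [cite: AntoniouLu2007, §15.4.1 (15.55a); Problem 15.6] -/
theorem newtonDir_dx_eq {H : Matrix ι ι ℝ} {A : Matrix κ ι ℝ} {g : ι → ℝ} {c lam y : κ → ℝ}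
    (hy : ∀ j, 0 < y j) {τ : ℝ} {dx : ι → ℝ} {dy dlam : κ → ℝ}
    (hN : IsUnit (dualNormal H A y lam).det) (h : IsNewtonDir H A g c y lam τ dx dy dlam) :
    dx = (dualNormal H A y lam)⁻¹ *ᵥ
      (-xi g A y τ + Aᵀ *ᵥ fun j => lam j / y j * (y j - c j)) := by
  obtain ⟨h1, -, -⟩ := (isNewtonDir_iff_explicit H A g c lam hy τ dx dy dlam).mp h
  rw [← h1, mulVec_mulVec, nonsing_inv_mul _ hN, one_mulVec]

/-- (15.55a) as printed: `Δx = −N⁻¹g + τ N⁻¹AᵀY⁻¹e + N⁻¹AᵀY⁻¹Λρ`.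
[cite: AntoniouLu2007, §15.4.1 (15.55a); Problem 15.6] -/
theorem newtonDir_dx_eq_three_terms {H : Matrix ι ι ℝ} {A : Matrix κ ι ℝ} {g : ι → ℝ}
    {c lam y : κ → ℝ} (hy : ∀ j, 0 < y j) {τ : ℝ} {dx : ι → ℝ} {dy dlam : κ → ℝ}
    (hN : IsUnit (dualNormal H A y lam).det) (h : IsNewtonDir H A g c y lam τ dx dy dlam) :
    dx = -((dualNormal H A y lam)⁻¹ *ᵥ g) +
        τ • (dualNormal H A y lam)⁻¹ *ᵥ (Aᵀ *ᵥ fun j => (y j)⁻¹) +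
        (dualNormal H A y lam)⁻¹ *ᵥ (Aᵀ *ᵥ fun j => lam j / y j * (y j - c j)) := by
  have hτ : (fun j => τ / y j) = τ • fun j => (y j)⁻¹ := by
    funext j
    simp [div_eq_mul_inv]
  rw [newtonDir_dx_eq hy hN h, xi, hτ, mulVec_smul, neg_sub, sub_eq_add_neg, add_comm (τ • _),
    mulVec_add, mulVec_add, mulVec_neg, mulVec_smul]

/-- Conversely, (15.55) solves (15.50): with `Δx = N⁻¹(−ξ + AᵀY⁻¹Λρ)` ((15.55a)),
`Δy = AΔx − ρ` ((15.55b)) and `Δλ = Y⁻¹Λ(ρ − AΔx) + γ` ((15.55c)), the triple is the Newton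
direction. [cite: AntoniouLu2007, §15.4.1 (15.55a)–(15.55c); Problem 15.6] -/
theorem isNewtonDir_of_explicit {H : Matrix ι ι ℝ} {A : Matrix κ ι ℝ} {g : ι → ℝ}
    {c lam y : κ → ℝ} (hy : ∀ j, 0 < y j) {τ : ℝ} {dx : ι → ℝ} {dy dlam : κ → ℝ}
    (hN : IsUnit (dualNormal H A y lam).det)
    (hdx : dx = (dualNormal H A y lam)⁻¹ *ᵥ
      (-xi g A y τ + Aᵀ *ᵥ fun j => lam j / y j * (y j - c j)))
    (hdy : dy = A *ᵥ dx - (y - c))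
    (hdlam : dlam = fun j => lam j / y j * ((y j - c j) - (A *ᵥ dx) j) + (τ / y j - lam j)) :
    IsNewtonDir H A g c y lam τ dx dy dlam :=
  (isNewtonDir_iff_explicit H A g c lam hy τ dx dy dlam).mpr
    ⟨by rw [hdx, mulVec_mulVec, mul_nonsing_inv _ hN, one_mulVec], hdy, hdlam⟩

/-! ## Problem 15.7 and the convex case: definiteness of the dual normal matrix -/

omit [DecidableEq ι] in
/-- `Aᵀ diag(d) A ⪰ 0` for `d ≥ 0`. [folklore] -/
private theorem posSemidef_transpose_mul_diagonal_mul (A : Matrix κ ι ℝ) {d : κ → ℝ}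
    (hd : ∀ j, 0 ≤ d j) : (Aᵀ * diagonal d * A).PosSemidef := by
  have h := (PosSemidef.diagonal (show 0 ≤ d from fun j => hd j)).conjTranspose_mul_mul_same A
  simpa only [conjTranspose_eq_transpose_of_trivial] using h

omit [DecidableEq ι] in
/-- `Aᵀ diag(d) A ≻ 0` for `d > 0` and `A` with trivial kernel. [folklore] -/
private theorem posDef_transpose_mul_diagonal_mul {A : Matrix κ ι ℝ} {d : κ → ℝ}
    (hd : ∀ j, 0 < d j) (hA : Function.Injective A.mulVec) : (Aᵀ * diagonal d * A).PosDef := by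
  have h := (PosDef.diagonal hd).conjTranspose_mul_mul_same hA
  simpa only [conjTranspose_eq_transpose_of_trivial] using h

omit [DecidableEq ι] in
/-- Problem 15.7: if the Hessian of the Lagrangian `H(x, λ)` is positive definite (and `y > 0`,
`λ ≥ 0`, as at every interior iterate) then the dual normal matrix `N(x, y, λ)` is positive
definite. [cite: AntoniouLu2007, §15.4.2; Problem 15.7] -/
theorem posDef_dualNormal {H : Matrix ι ι ℝ} (hH : H.PosDef) (A : Matrix κ ι ℝ) {y lam : κ → ℝ}
    (hy : ∀ j, 0 < y j) (hlam : ∀ j, 0 ≤ lam j) : (dualNormal H A y lam).PosDef :=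
  hH.add_posSemidef (posSemidef_transpose_mul_diagonal_mul A fun j => div_nonneg (hlam j) (hy j).le)

omit [DecidableEq ι] in
/-- `H ⪰ 0`, `y > 0`, `λ ≥ 0 ⟹ N ⪰ 0` (the convex case: `f` convex and all `c_j` concave give
`H = ∇²f − Σ λ_j ∇²c_j ⪰ 0` for `λ ≥ 0`). [cite: AntoniouLu2007, §15.4.2 (15.56); Problem 15.7] -/
theorem posSemidef_dualNormal {H : Matrix ι ι ℝ} (hH : H.PosSemidef) (A : Matrix κ ι ℝ)
    {y lam : κ → ℝ} (hy : ∀ j, 0 < y j) (hlam : ∀ j, 0 ≤ lam j) :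
    (dualNormal H A y lam).PosSemidef :=
  hH.add (posSemidef_transpose_mul_diagonal_mul A fun j => div_nonneg (hlam j) (hy j).le)

omit [DecidableEq ι] in
/-- The convex case made precise: `H ⪰ 0`, `y > 0`, `λ > 0` and `A` of full column rank
(`A v = 0 ⟹ v = 0`) give `N ≻ 0` — the hypothesis under which §15.4.2 concludes that the
direction (15.55) is a descent direction for `ψ_{β,τ}` for a suitable `β`.
[cite: AntoniouLu2007, §15.4.2 (15.56); Problem 15.7] -/
theorem posDef_dualNormal_of_injective {H : Matrix ι ι ℝ} (hH : H.PosSemidef) {A : Matrix κ ι ℝ}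
    (hA : Function.Injective A.mulVec) {y lam : κ → ℝ} (hy : ∀ j, 0 < y j)
    (hlam : ∀ j, 0 < lam j) : (dualNormal H A y lam).PosDef :=
  PosDef.posSemidef_add hH (posDef_transpose_mul_diagonal_mul (fun j => div_pos (hlam j) (hy j)) hA)

/-- The remark of §15.4.2: on the perturbed central path, (15.48b) `YΛe = τe` with `τ > 0` and
`y > 0` forces `λ > 0`. [cite: AntoniouLu2007, §15.4.1 (15.48b); §15.4.2] -/
theorem multiplier_pos_of_central {τ yj lamj : ℝ} (hτ : 0 < τ) (hy : 0 < yj)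
    (h : yj * lamj = τ) : 0 < lamj := by
  by_contra hneg
  have : yj * lamj ≤ 0 := mul_nonpos_of_nonneg_of_nonpos hy.le (not_lt.mp hneg)
  linarith

/-! ## (15.57)–(15.58), Problem 15.8: the merit function and the slope identity -/

/-- `s = ∇ₓψ_{β,τ}ᵀ Δx + ∇_yψ_{β,τ}ᵀ Δy` with `∇ₓψ_{β,τ} = g − β Aᵀρ` and
`∇_yψ_{β,τ} = −τY⁻¹e + βρ`, `ρ = y − c(x)` (the first line of (15.58)).
[cite: AntoniouLu2007, §15.4.2 (15.57)–(15.58)] -/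
noncomputable def meritSlope (g dx : ι → ℝ) (A : Matrix κ ι ℝ) (y ρ dy : κ → ℝ) (τ β : ℝ) : ℝ :=
  (g - β • (Aᵀ *ᵥ ρ)) ⬝ᵥ dx + (fun j => -(τ / y j) + β * ρ j) ⬝ᵥ dy

omit [DecidableEq ι] [DecidableEq κ] in
/-- The derivative at `α = 0` of the merit function (15.57) along the search direction,
`α ↦ ψ_{β,τ}(x + αΔx, y + αΔy) = f(x + αΔx) − τ Σ ln(y_j + αΔy_j) + (β/2)‖y + αΔy − c(x + αΔx)‖²`,
in terms of the directional derivatives `gᵀΔx` of `f` and `AΔx` of `c` along the line (`φ` and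
`cl` are the restrictions of `f` and `c` to the line; `y > 0`).
[cite: AntoniouLu2007, §15.4.2 (15.57)–(15.58); Problem 15.8] -/
theorem hasDerivAt_merit_line {φ : ℝ → ℝ} {cl : ℝ → κ → ℝ} {g dx : ι → ℝ} {A : Matrix κ ι ℝ}
    {c y : κ → ℝ} (hφ : HasDerivAt φ (g ⬝ᵥ dx) 0)
    (hcl : ∀ j, HasDerivAt (fun a => cl a j) ((A *ᵥ dx) j) 0) (hcl0 : cl 0 = c)
    (hy : ∀ j, 0 < y j) (dy : κ → ℝ) (τ β : ℝ) :
    HasDerivAt (fun a => φ a - τ * ∑ j, Real.log (y j + a * dy j) +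
        β / 2 * ∑ j, (y j + a * dy j - cl a j) ^ 2)
      (g ⬝ᵥ dx - τ * ∑ j, dy j / y j + β * ∑ j, (y j - c j) * (dy j - (A *ᵥ dx) j)) 0 := by
  have hlin : ∀ j, HasDerivAt (fun a : ℝ => y j + a * dy j) (dy j) 0 := fun j => by
    simpa using (hasDerivAt_mul_const (dy j)).const_add (y j)
  have hlog : ∀ j, HasDerivAt (fun a : ℝ => Real.log (y j + a * dy j)) (dy j / y j) 0 := fun j => by
    have h := (hlin j).log (by simpa using (hy j).ne')
    simpa using h
  have hsq : ∀ j, HasDerivAt (fun a : ℝ => (y j + a * dy j - cl a j) ^ 2)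
      (2 * (y j - c j) * (dy j - (A *ᵥ dx) j)) 0 := fun j => by
    have h := ((hlin j).sub (hcl j)).fun_pow 2
    refine h.congr_deriv ?_
    simp [hcl0]
  have hsum1 : HasDerivAt (fun a : ℝ => ∑ j, Real.log (y j + a * dy j)) (∑ j, dy j / y j) 0 :=
    HasDerivAt.fun_sum fun j _ => hlog j
  have hsum2 : HasDerivAt (fun a : ℝ => ∑ j, (y j + a * dy j - cl a j) ^ 2)
      (∑ j, 2 * (y j - c j) * (dy j - (A *ᵥ dx) j)) 0 :=
    HasDerivAt.fun_sum fun j _ => hsq j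
  have h := (hφ.sub (hsum1.const_mul τ)).add (hsum2.const_mul (β / 2))
  refine h.congr_deriv ?_
  simp only [Finset.mul_sum]
  congr 1
  exact Finset.sum_congr rfl fun j _ => by ring

omit [DecidableEq ι] [DecidableEq κ] in
/-- The value computed in `hasDerivAt_merit_line` is the slope `s` of (15.58) (gradient of
`ψ_{β,τ}` dotted with the direction), with `ρ = y − c`.
[cite: AntoniouLu2007, §15.4.2 (15.58); Problem 15.8] -/
theorem meritLineDeriv_eq_meritSlope (g dx : ι → ℝ) (A : Matrix κ ι ℝ) (c y dy : κ → ℝ)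
    (τ β : ℝ) :
    g ⬝ᵥ dx - τ * ∑ j, dy j / y j + β * ∑ j, (y j - c j) * (dy j - (A *ᵥ dx) j) =
      meritSlope g dx A y (y - c) dy τ β := by
  unfold meritSlope
  rw [sub_dotProduct, smul_dotProduct, mulVec_transpose, ← dotProduct_mulVec, smul_eq_mul]
  have h1 : (fun j => -(τ / y j) + β * (y - c) j) ⬝ᵥ dy =
      -(τ * ∑ j, dy j / y j) + β * ((y - c) ⬝ᵥ dy) := by
    simp only [dotProduct, Finset.mul_sum, ← Finset.sum_neg_distrib, ← Finset.sum_add_distrib]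
    exact Finset.sum_congr rfl fun j _ => by ring
  have h2 : ∑ j, (y j - c j) * (dy j - (A *ᵥ dx) j) = (y - c) ⬝ᵥ dy - (y - c) ⬝ᵥ (A *ᵥ dx) := by
    simp only [dotProduct, Pi.sub_apply, ← Finset.sum_sub_distrib]
    exact Finset.sum_congr rfl fun j _ => by ring
  rw [h1, h2]
  ring

omit [DecidableEq ι] [DecidableEq κ] in
/-- With `Δy = AΔx − ρ` (the third block row), the slope collapses to
`s = ξᵀΔx + τ eᵀY⁻¹ρ − β‖ρ‖²`, `ξ = g − τAᵀY⁻¹e`.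
[cite: AntoniouLu2007, §15.4.2 (15.58); Problem 15.8] -/
theorem meritSlope_eq_xi (g dx : ι → ℝ) (A : Matrix κ ι ℝ) (y ρ : κ → ℝ) {dy : κ → ℝ}
    (hdy : dy = A *ᵥ dx - ρ) (τ β : ℝ) :
    meritSlope g dx A y ρ dy τ β = xi g A y τ ⬝ᵥ dx + τ * ∑ j, ρ j / y j - β * ∑ j, ρ j ^ 2 := by
  unfold meritSlope xi
  rw [sub_dotProduct, sub_dotProduct, smul_dotProduct, mulVec_transpose, mulVec_transpose,
    ← dotProduct_mulVec, ← dotProduct_mulVec, smul_eq_mul, hdy]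
  simp only [dotProduct, Pi.sub_apply]
  have key : ∀ j, (-(τ / y j) + β * ρ j) * ((A *ᵥ dx) j - ρ j) =
      β * (ρ j * (A *ᵥ dx) j) - τ / y j * (A *ᵥ dx) j + τ * (ρ j / y j) - β * ρ j ^ 2 := by
    intro j
    ring
  simp only [key, Finset.sum_sub_distrib, Finset.sum_add_distrib, ← Finset.mul_sum]
  ring

omit [DecidableEq κ] in
/-- (15.58), Problem 15.8: if `Δy = AΔx − ρ` and `NΔx = −ξ + AᵀY⁻¹Λρ` with `N` invertible (for
the Newton direction this is `isNewtonDir_iff_explicit`; the same holds for the modified `N̂` of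
(15.64)), then
`s = −ξᵀN⁻¹ξ + τ eᵀY⁻¹ρ + ξᵀN⁻¹AᵀY⁻¹Λρ − β‖ρ‖²`.
[cite: AntoniouLu2007, §15.4.2 (15.58); Problem 15.8] -/
theorem meritSlope_eq {N : Matrix ι ι ℝ} (hN : IsUnit N.det) (g : ι → ℝ) (A : Matrix κ ι ℝ)
    (y lam ρ : κ → ℝ) (τ β : ℝ) {dx : ι → ℝ} {dy : κ → ℝ} (hdy : dy = A *ᵥ dx - ρ)
    (hdx : N *ᵥ dx = -xi g A y τ + Aᵀ *ᵥ fun j => lam j / y j * ρ j) :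
    meritSlope g dx A y ρ dy τ β =
      -(xi g A y τ ⬝ᵥ N⁻¹ *ᵥ xi g A y τ) + τ * ∑ j, ρ j / y j +
        xi g A y τ ⬝ᵥ N⁻¹ *ᵥ (Aᵀ *ᵥ fun j => lam j / y j * ρ j) - β * ∑ j, ρ j ^ 2 := by
  have hdx' : dx = N⁻¹ *ᵥ (-xi g A y τ + Aᵀ *ᵥ fun j => lam j / y j * ρ j) := by
    rw [← hdx, mulVec_mulVec, nonsing_inv_mul _ hN, one_mulVec]
  rw [meritSlope_eq_xi g dx A y ρ hdy τ β, hdx', mulVec_add, mulVec_neg, dotProduct_add,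
    dotProduct_neg]
  ring

/-! ## (15.59)–(15.60), Problem 15.9: choosing `β` -/

omit [DecidableEq ι] [DecidableEq κ] in
/-- The slope is affine in `β`: `s(β) = s(0) − β‖ρ‖²` (given `Δy = AΔx − ρ`), so that
`β_min = s(0)/‖ρ‖²` ((15.60), with `s(0) = −ξᵀN⁻¹ξ + τeᵀY⁻¹ρ + ξᵀN⁻¹AᵀY⁻¹Λρ` by (15.58)).
[cite: AntoniouLu2007, §15.4.2 (15.58)–(15.60); Problem 15.9] -/
theorem meritSlope_eq_sub_beta (g dx : ι → ℝ) (A : Matrix κ ι ℝ) (y ρ : κ → ℝ) {dy : κ → ℝ}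
    (hdy : dy = A *ᵥ dx - ρ) (τ β : ℝ) :
    meritSlope g dx A y ρ dy τ β = meritSlope g dx A y ρ dy τ 0 - β * ∑ j, ρ j ^ 2 := by
  rw [meritSlope_eq_xi g dx A y ρ hdy, meritSlope_eq_xi g dx A y ρ hdy]
  ring

omit [DecidableEq ι] [DecidableEq κ] in
/-- `‖ρ‖² > 0` for `ρ ≠ 0`. [folklore] -/
private theorem sum_sq_pos_of_ne_zero {ρ : κ → ℝ} (hρ : ρ ≠ 0) : 0 < ∑ j, ρ j ^ 2 := by
  obtain ⟨j, hj⟩ := Function.ne_iff.mp hρ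
  exact lt_of_lt_of_le (lt_of_le_of_ne (sq_nonneg (ρ j)) (Ne.symm (pow_ne_zero 2 hj)))
    (Finset.single_le_sum (f := fun j => ρ j ^ 2) (fun i _ => sq_nonneg (ρ i)) (Finset.mem_univ j))

omit [DecidableEq ι] [DecidableEq κ] in
/-- Problem 15.9 (strict form): if the iterate is infeasible (`ρ ≠ 0`) and `β > β_min = s(0)/‖ρ‖²`
then `s < 0`, i.e. `{Δx, Δy}` is a descent direction for `ψ_{β,τ}` — the text sets `β = 10 β_min`
when `s(0) ≥ 0`. [cite: AntoniouLu2007, §15.4.2 (15.59)–(15.60); Problem 15.9] -/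
theorem meritSlope_neg_of_betaMin_lt (g dx : ι → ℝ) (A : Matrix κ ι ℝ) (y : κ → ℝ) {ρ dy : κ → ℝ}
    (hdy : dy = A *ᵥ dx - ρ) (hρ : ρ ≠ 0) (τ : ℝ) {β : ℝ}
    (hβ : meritSlope g dx A y ρ dy τ 0 / ∑ j, ρ j ^ 2 < β) :
    meritSlope g dx A y ρ dy τ β < 0 := by
  have hpos := sum_sq_pos_of_ne_zero hρ
  rw [meritSlope_eq_sub_beta g dx A y ρ hdy τ β, sub_neg, ← div_lt_iff₀ hpos]
  exact hβ

omit [DecidableEq ι] [DecidableEq κ] in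
/-- Problem 15.9 as printed (`β ≥ β_min`) gives `s ≤ 0`.
[cite: AntoniouLu2007, §15.4.2 (15.60); Problem 15.9] -/
theorem meritSlope_nonpos_of_betaMin_le (g dx : ι → ℝ) (A : Matrix κ ι ℝ) (y : κ → ℝ)
    {ρ dy : κ → ℝ} (hdy : dy = A *ᵥ dx - ρ) (hρ : ρ ≠ 0) (τ : ℝ) {β : ℝ}
    (hβ : meritSlope g dx A y ρ dy τ 0 / ∑ j, ρ j ^ 2 ≤ β) :
    meritSlope g dx A y ρ dy τ β ≤ 0 := by
  have hpos := sum_sq_pos_of_ne_zero hρ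
  rw [meritSlope_eq_sub_beta g dx A y ρ hdy τ β, sub_nonpos, ← div_le_iff₀ hpos]
  exact hβ

omit [DecidableEq ι] [DecidableEq κ] in
/-- … and at `β = β_min` exactly the slope vanishes, so strict descent needs `β > β_min`.
[cite: AntoniouLu2007, §15.4.2 (15.60); Problem 15.9] -/
theorem meritSlope_eq_zero_of_eq_betaMin (g dx : ι → ℝ) (A : Matrix κ ι ℝ) (y : κ → ℝ)
    {ρ dy : κ → ℝ} (hdy : dy = A *ᵥ dx - ρ) (hρ : ρ ≠ 0) (τ : ℝ) :
    meritSlope g dx A y ρ dy τ (meritSlope g dx A y ρ dy τ 0 / ∑ j, ρ j ^ 2) = 0 := by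
  have hpos := sum_sq_pos_of_ne_zero hρ
  rw [meritSlope_eq_sub_beta g dx A y ρ hdy, div_mul_cancel₀ _ hpos.ne', sub_self]

omit [DecidableEq κ] in
/-- The feasible case behind (15.59): if `ρ = 0` then `s = −ξᵀN⁻¹ξ` for every `β`, which is
`< 0` when `N ≻ 0` and `ξ ≠ 0`. [cite: AntoniouLu2007, §15.4.2 (15.58)–(15.59)] -/
theorem meritSlope_neg_of_feasible {N : Matrix ι ι ℝ} (hN : N.PosDef) (g : ι → ℝ)
    (A : Matrix κ ι ℝ) (y lam : κ → ℝ) (τ β : ℝ) {dx : ι → ℝ} {ρ dy : κ → ℝ}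
    (hdy : dy = A *ᵥ dx - ρ) (hdx : N *ᵥ dx = -xi g A y τ + Aᵀ *ᵥ fun j => lam j / y j * ρ j)
    (hρ : ρ = 0) (hξ : xi g A y τ ≠ 0) : meritSlope g dx A y ρ dy τ β < 0 := by
  have hNd : IsUnit N.det := (isUnit_iff_isUnit_det N).mp hN.isUnit
  rw [meritSlope_eq hNd g A y lam ρ τ β hdy hdx]
  have hq : 0 < xi g A y τ ⬝ᵥ N⁻¹ *ᵥ xi g A y τ := by
    simpa using hN.inv.dotProduct_mulVec_pos hξ
  have h0 : (fun j => lam j / y j * ρ j) = 0 := funext fun j => by simp [hρ]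
  rw [h0, mulVec_zero, mulVec_zero, dotProduct_zero]
  subst hρ
  simp only [Pi.zero_apply, zero_div, Finset.sum_const_zero, mul_zero, add_zero, ne_eq,
    OfNat.ofNat_ne_zero, not_false_eq_true, zero_pow, sub_zero]
  linarith

omit [DecidableEq κ] in
/-- The necessity statement around (15.59): if `N ≻ 0`, `β ≥ 0` and the direction is *not* a
descent direction (`s ≥ 0`), then `τeᵀY⁻¹ρ + ξᵀN⁻¹AᵀY⁻¹Λρ ≥ ξᵀN⁻¹ξ + β‖ρ‖² (≥ 0)`.
[cite: AntoniouLu2007, §15.4.2 (15.58)–(15.59); Problem 15.9] -/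
theorem descent_obstruction_nonneg {N : Matrix ι ι ℝ} (hN : N.PosDef) (g : ι → ℝ)
    (A : Matrix κ ι ℝ) (y lam ρ : κ → ℝ) (τ : ℝ) {β : ℝ} (hβ : 0 ≤ β) {dx : ι → ℝ} {dy : κ → ℝ}
    (hdy : dy = A *ᵥ dx - ρ) (hdx : N *ᵥ dx = -xi g A y τ + Aᵀ *ᵥ fun j => lam j / y j * ρ j)
    (hs : 0 ≤ meritSlope g dx A y ρ dy τ β) :
    xi g A y τ ⬝ᵥ N⁻¹ *ᵥ xi g A y τ + β * ∑ j, ρ j ^ 2 ≤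
        τ * ∑ j, ρ j / y j + xi g A y τ ⬝ᵥ N⁻¹ *ᵥ (Aᵀ *ᵥ fun j => lam j / y j * ρ j) ∧
      0 ≤ τ * ∑ j, ρ j / y j + xi g A y τ ⬝ᵥ N⁻¹ *ᵥ (Aᵀ *ᵥ fun j => lam j / y j * ρ j) := by
  have hNd : IsUnit N.det := (isUnit_iff_isUnit_det N).mp hN.isUnit
  rw [meritSlope_eq hNd g A y lam ρ τ β hdy hdx] at hs
  have hq : 0 ≤ xi g A y τ ⬝ᵥ N⁻¹ *ᵥ xi g A y τ := by
    simpa using hN.inv.posSemidef.dotProduct_mulVec_nonneg (xi g A y τ)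
  have hr : 0 ≤ β * ∑ j, ρ j ^ 2 := mul_nonneg hβ (Finset.sum_nonneg fun j _ => sq_nonneg (ρ j))
  constructor <;> linarith

omit [DecidableEq κ] in
/-- (15.59) with the strict sign of the text: under the same hypotheses and `ξ ≠ 0`,
`τeᵀY⁻¹ρ + ξᵀN⁻¹AᵀY⁻¹Λρ > 0`. [cite: AntoniouLu2007, §15.4.2 (15.59); Problem 15.9] -/
theorem descent_obstruction_pos {N : Matrix ι ι ℝ} (hN : N.PosDef) (g : ι → ℝ)
    (A : Matrix κ ι ℝ) (y lam ρ : κ → ℝ) (τ : ℝ) {β : ℝ} (hβ : 0 ≤ β) {dx : ι → ℝ} {dy : κ → ℝ}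
    (hdy : dy = A *ᵥ dx - ρ) (hdx : N *ᵥ dx = -xi g A y τ + Aᵀ *ᵥ fun j => lam j / y j * ρ j)
    (hs : 0 ≤ meritSlope g dx A y ρ dy τ β) (hξ : xi g A y τ ≠ 0) :
    0 < τ * ∑ j, ρ j / y j + xi g A y τ ⬝ᵥ N⁻¹ *ᵥ (Aᵀ *ᵥ fun j => lam j / y j * ρ j) := by
  have h := (descent_obstruction_nonneg hN g A y lam ρ τ hβ hdy hdx hs).1
  have hq : 0 < xi g A y τ ⬝ᵥ N⁻¹ *ᵥ xi g A y τ := by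
    simpa using hN.inv.dotProduct_mulVec_pos hξ
  have hr : 0 ≤ β * ∑ j, ρ j ^ 2 := mul_nonneg hβ (Finset.sum_nonneg fun j _ => sq_nonneg (ρ j))
  linarith

/-! ## (15.63)–(15.65): the Hessian shift for nonconvex problems -/

omit [DecidableEq ι] in
/-- (15.63)–(15.64): if `η` exceeds the magnitude of every negative eigenvalue of the symmetric
matrix `H(x, λ)` (`−η < λᵢ(H)` for all `i`) then `Ĥ = H + ηI ≻ 0` — this equivalence is
`Literature.Analysis.Convex.SemidefiniteStepLength.add_smul_one_posDef_iff_eigenvalues` — and hence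
the modified dual normal matrix `N̂(x, y, λ) = Ĥ(x, λ) + AᵀY⁻¹ΛA` ((15.64)) is positive definite
(`y > 0`, `λ ≥ 0`), so the analysis of §15.4.2 (`meritSlope_eq` with `N̂`,
`meritSlope_neg_of_betaMin_lt`) applies. [cite: AntoniouLu2007, §15.4.3 (15.63)–(15.64)] -/
theorem posDef_dualNormal_shift [DecidableEq ι] {H : Matrix ι ι ℝ} (hH : H.IsHermitian) {η : ℝ}
    (hη : ∀ i, -η < hH.eigenvalues i) (A : Matrix κ ι ℝ) {y lam : κ → ℝ} (hy : ∀ j, 0 < y j)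
    (hlam : ∀ j, 0 ≤ lam j) : (dualNormal (H + η • (1 : Matrix ι ι ℝ)) A y lam).PosDef :=
  posDef_dualNormal ((SemidefiniteStepLength.add_smul_one_posDef_iff_eigenvalues hH η).mpr hη) A hy
    hlam

omit [DecidableEq ι] in
/-- The text's choice below (15.65): with `η₀ > 0` the magnitude of the most negative eigenvalue of
`H` (so `−η₀ ≤ λᵢ(H)` for all `i`), the upper bound `η̄ = 1.2 η₀` already gives a positive definite
modified dual normal matrix ("evidently, with `η = η̄` … `N(x, y, λ)` in Eq. (15.64) is positive
definite"). [cite: AntoniouLu2007, §15.4.3 (15.63)–(15.65)] -/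
theorem posDef_dualNormal_eta_bar [DecidableEq ι] {H : Matrix ι ι ℝ} (hH : H.IsHermitian) {η₀ : ℝ}
    (h₀ : 0 < η₀) (hmin : ∀ i, -η₀ ≤ hH.eigenvalues i) (A : Matrix κ ι ℝ) {y lam : κ → ℝ}
    (hy : ∀ j, 0 < y j) (hlam : ∀ j, 0 ≤ lam j) :
    (dualNormal (H + (1.2 * η₀) • (1 : Matrix ι ι ℝ)) A y lam).PosDef :=
  posDef_dualNormal_shift hH (fun i => by have := hmin i; linarith) A hy hlam

end Literature.Analysis.Convex.InteriorPointMeritFunction
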